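import Mathlib
import HarnessLib
import Summits.PneNP.PneNP.Theses.AeaCutRectangles
import Summits.PneNP.PneNP.Theorems.AeaCutRectanglesNoSparseSupports
import Literature.NumberTheory.Transcendental.RivoalLinearForms

/-!
# Crux `FoolingMeasure` (stmt-PneNP-19727) — negative lemma: X1 is false under the HALF-SPARSE-CORE hypothesis

Lead prover pnp-aea-p1 g2 (2026-08-27), route `AeaCutRectangles`.  X1
`Summit.PneNP.PneNP.Theses.AeaCutRectangles.FoolingMeasure` asks (some `ε ∈ (0,1/4]`, every `C`, infinitely
many `n`) for probability measures on loopless non-3-colourable edge sets over `Fin n` all of whose cut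
rectangles over near-balanced cuts `B` (Alice: edges meeting `Fin n ∖ B`, Bob: edges inside `B`) have mass
`≤ 2^{-(n/2)·log₂ n - C·n}`.

HYPOTHESIS `hH` (HALF-SPARSE CORE; pure finite graph theory): every loopless non-3-colourable edge set `G` over
`Fin n` has a vertex set `S` with `2|S| ≥ n` and a non-3-colourable `F ⊆ G` with `2·|F[S]| ≤ n`.  Equivalently:
every 4-critical graph on `f` vertices has `≥ f/2` vertices spanning `≤ f/2` of its edges.  True for every family
this crux programme has met — `K₄`, odd wheels, Toft's dense 4-critical graphs (a half with `≈ n/8` edges), the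
Rödl–Stiebitz graphs, Mycielski / Kneser / Schrijver graphs (independent halves), the Jensen–Royle 13-vertex and
Jensen 24-vertex regular 4-critical graphs (exhaustive: halves with 4 ≤ 6.5, resp. 6 ≤ 12 edges) — and
heuristically for every cut-pseudo-random 4-critical graph of average degree `< 9.4` (max-cut asymptotics).  A
counterexample is a "bisection-robust" 4-critical graph (average degree `≳ 9`, every half dense), next to
Erdős's open problem on 4-critical graphs of linear minimum degree and the unknown regular 4-critical graphs of
degree `≥ 6` (Jensen–Toft, *Graph Coloring Problems* (1995) Problems 5.1–5.2; Toft, *Handbook of Combinatorics*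
ch. 4 §2.3).

THEOREM `foolingMeasure_false_of_halfSparseCore : hH → ¬ FoolingMeasure`.  Mechanism (BOB-SUPERSET RECTANGLES,
`bobSupset_sum_le_rect`): for a cut `B` and an edge set `H` inside `B`, {Alice parts `α` : `α ∪ H`
non-3-colourable} × {Bob parts `β ⊇ H`} is a cut rectangle inside NON-3-COL containing every support graph
`G ⊇ F`, `F` non-3-colourable with `F[B] = H`.  Under `hH` every support graph is captured at a cut `B ⊆ S`,
`|B| = ⌈n/2⌉`, by the rectangle of `H = F[B]`, `|H| ≤ n/2`; there are `≤ 2^n·(n/2+1)·C(|Sym2 (Fin n)|, n/2) ≤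
2^n·n·(11n)^{n/2}` of them (`card_filter_card_le_choose` and the tree's Stirling bound
`Literature.NumberTheory.Transcendental.RivoalSeries.choose_le_exp_pow`), while X1 at
`C = 4` gives each mass `≤ n^{-n/2}·2^{-4n}` — total `< n/2^n < 1`.  So X1 implies the negation of `hH`:
bisection-robust 4-critical cores exist for infinitely many `n` (and, by the route's other necessary conditions,
in superexponentially many non-isomorphic, interface-incompressible copies).

HONEST FRAMING: a conditional refutation (`¬X1` modulo a graph-theoretic hypothesis the tree cannot yet decide);
FRONTIER material for a rung of Fagin's complement ladder (NON-3-COL vs ESO(∀∃∀)); restricted-model witness —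
nothing here bears on P vs NP.
-/


set_option linter.dupNamespace false
set_option autoImplicit false

namespace Summit.PneNP.PneNP.Theorems.FoolingMeasure.Negative

open Finset
open Summit.PneNP.PneNP.Theorems.AeaCutRectanglesDutyRectangles
open Summit.PneNP.PneNP.Theorems.AeaCutRectanglesSparseWitnesses
open Summit.PneNP.PneNP.Theorems.AeaCutRectanglesNoSparseSupports

/-! ### Bob-superset rectangles -/

section General

variable {V : Type*} [Fintype V] [DecidableEq V]

/-- Bob's side is monotone in the edge set. -/
theorem bobSide_mono (B : Finset V) {F G : Finset (Sym2 V)} (h : F ⊆ G) : bobSide B F ⊆ bobSide B G :=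
  fun _ he => mem_bobSide.2 ⟨h (mem_bobSide.1 he).1, (mem_bobSide.1 he).2⟩

/-- Alice's side is monotone in the edge set. -/
theorem aliceSide_mono (B : Finset V) {F G : Finset (Sym2 V)} (h : F ⊆ G) :
    aliceSide B F ⊆ aliceSide B G :=
  fun _ he => mem_aliceSide.2 ⟨h (mem_aliceSide.1 he).1, (mem_aliceSide.1 he).2⟩

/-- Bob's side is monotone in the cut. -/
theorem bobSide_mono_left {B S : Finset V} (h : B ⊆ S) (F : Finset (Sym2 V)) :
    bobSide B F ⊆ bobSide S F :=
  fun _ he => mem_bobSide.2 ⟨(mem_bobSide.1 he).1, fun v hv => h ((mem_bobSide.1 he).2 v hv)⟩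

/-- A subgraph lies inside "Alice's side of the big graph ∪ Bob's side of the subgraph". -/
theorem subset_aliceSide_union_bobSide (B : Finset V) {F G : Finset (Sym2 V)} (h : F ⊆ G) :
    F ⊆ aliceSide B G ∪ bobSide B F := by
  intro e he
  have he' : e ∈ aliceSide B F ∪ bobSide B F := by rw [aliceSide_union_bobSide]; exact he
  rcases mem_union.1 he' with h1 | h2
  · exact mem_union.2 (Or.inl (aliceSide_mono B h h1))
  · exact mem_union.2 (Or.inr h2)

/-- **Bob-superset rectangles.**  For `μ ≥ 0` supported on loopless non-3-colourable edge sets, a cut `B`, an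
edge set `H` and any family `T` of graphs `G` carrying mass only if `H ⊆ G[B]` and `(G ∖ G[B]) ∪ H` is
non-3-colourable, there is a cut rectangle over `B` inside NON-3-COL (X1's three hypotheses verbatim) of mass at
least `μ(T)`: Alice parts = the outside parts of the members of `T`, Bob parts = their inside parts (all `⊇ H`). -/
theorem bobSupset_sum_le_rect (μ : Finset (Sym2 V) → ℝ) (hμ : ∀ S, 0 ≤ μ S)
    (hs : ∀ S, μ S ≠ 0 → (∀ e ∈ S, ¬ e.IsDiag) ∧
      ¬ (SimpleGraph.fromEdgeSet (S : Set (Sym2 V))).Colorable 3)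
    (B : Finset V) (H : Finset (Sym2 V)) (T : Finset (Finset (Sym2 V)))
    (hT : ∀ G ∈ T, μ G ≠ 0 → H ⊆ bobSide B G ∧
      ¬ (SimpleGraph.fromEdgeSet ((aliceSide B G ∪ H : Finset (Sym2 V)) : Set (Sym2 V))).Colorable 3) :
    ∃ 𝓐 𝓑 : Finset (Finset (Sym2 V)),
      (∀ α ∈ 𝓐, ∀ e ∈ α, ¬ e.IsDiag ∧ ∃ v ∈ e, v ∉ B) ∧
      (∀ β ∈ 𝓑, ∀ e ∈ β, ¬ e.IsDiag ∧ ∀ v ∈ e, v ∈ B) ∧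
      (∀ α ∈ 𝓐, ∀ β ∈ 𝓑,
        ¬ (SimpleGraph.fromEdgeSet ((α ∪ β : Finset (Sym2 V)) : Set (Sym2 V))).Colorable 3) ∧
      ∑ G ∈ T, μ G ≤ ∑ q ∈ 𝓐 ×ˢ 𝓑, μ (q.1 ∪ q.2) := by
  classical
  set F : Finset (Finset (Sym2 V)) := T.filter (fun G => μ G ≠ 0) with hF
  refine ⟨F.image (aliceSide B), F.image (bobSide B), ?_, ?_, ?_, ?_⟩
  · intro α hα e he
    obtain ⟨G, hG, rfl⟩ := mem_image.1 hα
    obtain ⟨heG, hout⟩ := mem_aliceSide.1 he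
    exact ⟨(hs G (mem_filter.1 hG).2).1 e heG, hout⟩
  · intro β hβ e he
    obtain ⟨G, hG, rfl⟩ := mem_image.1 hβ
    obtain ⟨heG, hin⟩ := mem_bobSide.1 he
    exact ⟨(hs G (mem_filter.1 hG).2).1 e heG, hin⟩
  · intro α hα β hβ
    obtain ⟨G, hG, rfl⟩ := mem_image.1 hα
    obtain ⟨G', hG', rfl⟩ := mem_image.1 hβ
    obtain ⟨hGT, hGμ⟩ := mem_filter.1 hG
    obtain ⟨hG'T, hG'μ⟩ := mem_filter.1 hG'
    obtain ⟨-, hA⟩ := hT G hGT hGμ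
    obtain ⟨hHB', -⟩ := hT G' hG'T hG'μ
    exact not_colorable_of_subset (union_subset_union (Subset.refl _) hHB') hA
  · have hinj : ∀ G ∈ F, ∀ G' ∈ F,
        (aliceSide B G, bobSide B G) = (aliceSide B G', bobSide B G') → G = G' := by
      intro G _ G' _ h
      have h1 : aliceSide B G = aliceSide B G' := congrArg Prod.fst h
      have h2 : bobSide B G = bobSide B G' := congrArg Prod.snd h
      rw [← aliceSide_union_bobSide B G, ← aliceSide_union_bobSide B G', h1, h2]
    calc ∑ G ∈ T, μ G = ∑ G ∈ F, μ G := (sum_filter_ne_zero T).symm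
      _ = ∑ G ∈ F, μ ((aliceSide B G, bobSide B G).1 ∪ (aliceSide B G, bobSide B G).2) := by
          refine sum_congr rfl fun G _ => ?_
          show μ G = μ (aliceSide B G ∪ bobSide B G)
          rw [aliceSide_union_bobSide]
      _ = ∑ q ∈ F.image (fun G => (aliceSide B G, bobSide B G)), μ (q.1 ∪ q.2) := by
          rw [sum_image hinj]
      _ ≤ ∑ q ∈ F.image (aliceSide B) ×ˢ F.image (bobSide B), μ (q.1 ∪ q.2) := by
          apply sum_le_sum_of_subset_of_nonneg
          · intro q hq
            obtain ⟨G, hG, rfl⟩ := mem_image.1 hq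
            exact mem_product.2 ⟨mem_image_of_mem _ hG, mem_image_of_mem _ hG⟩
          · intro q _ _
            exact hμ _

/-- **Bob-superset bound.**  X1's rectangle clause at the cut `B` with bound `δ` forces `μ(T) ≤ δ` for every
family `T` as in `bobSupset_sum_le_rect`. -/
theorem bobSupset_le_of_rectClause (μ : Finset (Sym2 V) → ℝ) (hμ : ∀ S, 0 ≤ μ S)
    (hs : ∀ S, μ S ≠ 0 → (∀ e ∈ S, ¬ e.IsDiag) ∧
      ¬ (SimpleGraph.fromEdgeSet (S : Set (Sym2 V))).Colorable 3)
    {B : Finset V} {δ : ℝ}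
    (hclause : ∀ 𝓐 𝓑 : Finset (Finset (Sym2 V)),
      (∀ α ∈ 𝓐, ∀ e ∈ α, ¬ e.IsDiag ∧ ∃ v ∈ e, v ∉ B) →
      (∀ β ∈ 𝓑, ∀ e ∈ β, ¬ e.IsDiag ∧ ∀ v ∈ e, v ∈ B) →
      (∀ α ∈ 𝓐, ∀ β ∈ 𝓑,
        ¬ (SimpleGraph.fromEdgeSet ((α ∪ β : Finset (Sym2 V)) : Set (Sym2 V))).Colorable 3) →
      ∑ q ∈ 𝓐 ×ˢ 𝓑, μ (q.1 ∪ q.2) ≤ δ)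
    (H : Finset (Sym2 V)) (T : Finset (Finset (Sym2 V)))
    (hT : ∀ G ∈ T, μ G ≠ 0 → H ⊆ bobSide B G ∧
      ¬ (SimpleGraph.fromEdgeSet ((aliceSide B G ∪ H : Finset (Sym2 V)) : Set (Sym2 V))).Colorable 3) :
    ∑ G ∈ T, μ G ≤ δ := by
  obtain ⟨𝓐, 𝓑, h𝓐, h𝓑, hN, hle⟩ := bobSupset_sum_le_rect μ hμ hs B H T hT
  exact hle.trans (hclause 𝓐 𝓑 h𝓐 h𝓑 hN)

/-- **Half-sparse cores are cheap.**  If every support graph of `μ` has a cut `B` in the window `W` and a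
non-3-colourable subgraph `F` with at most `m` edges inside `B`, and X1's clause holds with bound `δ ≥ 0` at
every cut of the window, then the TOTAL mass is at most `2^{|V|} · #{H : |H| ≤ m} · δ` (union bound over the
Bob-superset rectangles of the pairs `(B, F[B])`). -/
theorem total_le_of_halfSparseCore (μ : Finset (Sym2 V) → ℝ) (hμ : ∀ S, 0 ≤ μ S)
    (hs : ∀ S, μ S ≠ 0 → (∀ e ∈ S, ¬ e.IsDiag) ∧
      ¬ (SimpleGraph.fromEdgeSet (S : Set (Sym2 V))).Colorable 3)
    (W : Finset V → Prop) [DecidablePred W] {δ : ℝ} (hδ : 0 ≤ δ)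
    (hclause : ∀ B, W B → ∀ 𝓐 𝓑 : Finset (Finset (Sym2 V)),
      (∀ α ∈ 𝓐, ∀ e ∈ α, ¬ e.IsDiag ∧ ∃ v ∈ e, v ∉ B) →
      (∀ β ∈ 𝓑, ∀ e ∈ β, ¬ e.IsDiag ∧ ∀ v ∈ e, v ∈ B) →
      (∀ α ∈ 𝓐, ∀ β ∈ 𝓑,
        ¬ (SimpleGraph.fromEdgeSet ((α ∪ β : Finset (Sym2 V)) : Set (Sym2 V))).Colorable 3) →
      ∑ q ∈ 𝓐 ×ˢ 𝓑, μ (q.1 ∪ q.2) ≤ δ)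
    (m : ℕ)
    (hrestr : ∀ S, μ S ≠ 0 → ∃ B, W B ∧ ∃ F, F ⊆ S ∧
      ¬ (SimpleGraph.fromEdgeSet (F : Set (Sym2 V))).Colorable 3 ∧ (bobSide B F).card ≤ m) :
    ∑ S, μ S ≤ ((2 ^ Fintype.card V : ℕ) : ℝ) *
      ((((univ : Finset (Finset (Sym2 V))).filter (fun H => H.card ≤ m)).card : ℝ) * δ) := by
  classical
  set P : Finset (Finset (Sym2 V)) := univ.filter (fun H => H.card ≤ m) with hP
  set Wset : Finset (Finset V) := univ.filter W with hWset
  set I : Finset (Finset V × Finset (Sym2 V)) := Wset ×ˢ P with hI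
  have hcov : ∀ S, μ S ≠ 0 → ∃ q ∈ I, (fun (q : Finset V × Finset (Sym2 V)) (S : Finset (Sym2 V)) =>
      q.2 ⊆ bobSide q.1 S ∧
        ¬ (SimpleGraph.fromEdgeSet ((aliceSide q.1 S ∪ q.2 : Finset (Sym2 V)) : Set (Sym2 V))).Colorable 3)
      q S := by
    intro S hS
    obtain ⟨B, hB, F, hFS, hF, hc⟩ := hrestr S hS
    refine ⟨(B, bobSide B F), mem_product.2 ⟨mem_filter.2 ⟨mem_univ _, hB⟩,
      mem_filter.2 ⟨mem_univ _, hc⟩⟩, bobSide_mono B hFS, ?_⟩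
    exact not_colorable_of_subset (subset_aliceSide_union_bobSide B hFS) hF
  calc ∑ S, μ S ≤ ∑ q ∈ I, ∑ S ∈ univ.filter ((fun (q : Finset V × Finset (Sym2 V))
          (S : Finset (Sym2 V)) => q.2 ⊆ bobSide q.1 S ∧
          ¬ (SimpleGraph.fromEdgeSet ((aliceSide q.1 S ∪ q.2 : Finset (Sym2 V)) :
            Set (Sym2 V))).Colorable 3) q), μ S :=
        sum_le_sum_cover I _ μ hμ hcov
    _ ≤ ∑ _q ∈ I, δ := by
        refine sum_le_sum fun q hq => ?_
        obtain ⟨hB, -⟩ := mem_product.1 hq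
        exact bobSupset_le_of_rectClause μ hμ hs (hclause q.1 (mem_filter.1 hB).2) q.2 _
          (fun G hG _ => (mem_filter.1 hG).2)
    _ = (I.card : ℝ) * δ := by rw [sum_const, nsmul_eq_mul]
    _ ≤ ((2 ^ Fintype.card V : ℕ) : ℝ) * ((P.card : ℝ) * δ) := by
        rw [hI, card_product, Nat.cast_mul, mul_assoc]
        have h1 : Wset.card ≤ 2 ^ Fintype.card V := by
          calc Wset.card ≤ (univ : Finset (Finset V)).card := card_le_card (filter_subset _ _)
            _ = 2 ^ Fintype.card V := by rw [card_univ, Fintype.card_finset]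
        exact mul_le_mul_of_nonneg_right (by exact_mod_cast h1) (mul_nonneg (by positivity) hδ)

end General

/-- **The count beats the threshold (Stirling form).**  For `n ≥ 2`:
`2^n · (n/2+1) · C(|Sym2 (Fin n)|, n/2) · 2^{-(n/2)·log₂ n - 4n} < 1`. -/
theorem halfSparse_count_lt_one {n : ℕ} (hn : 2 ≤ n) :
    ((2 ^ n : ℕ) : ℝ) * ((((n / 2 + 1) * (Fintype.card (Sym2 (Fin n))).choose (n / 2) : ℕ) : ℝ) *
      (2 : ℝ) ^ (-((n : ℝ) / 2 * Real.logb 2 n) - ((4 : ℕ) : ℝ) * n)) < 1 := by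
  set m : ℕ := n / 2 with hm
  set N : ℕ := Fintype.card (Sym2 (Fin n)) with hN
  have hm1 : 1 ≤ m := by omega
  have h2m : 2 * m ≤ n := by omega
  have h2m' : n ≤ 2 * m + 1 := by omega
  have hn1 : (1 : ℝ) ≤ n := by exact_mod_cast (show 1 ≤ n by omega)
  have hn0 : (0 : ℝ) < n := by linarith
  have hA : (0 : ℝ) < (n : ℝ) ^ ((n : ℝ) / 2) := Real.rpow_pos_of_pos hn0 _
  -- the threshold splits as n^{-n/2} · 2^{-4n}
  have hsplit : (2 : ℝ) ^ (-((n : ℝ) / 2 * Real.logb 2 n) - ((4 : ℕ) : ℝ) * n) =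
      ((n : ℝ) ^ ((n : ℝ) / 2))⁻¹ * ((2 : ℝ) ^ (4 * n))⁻¹ := by
    rw [Real.rpow_sub (by norm_num), Real.rpow_neg (by norm_num), two_rpow_half_logb (by omega),
      div_eq_mul_inv]
    congr 2
    rw [show ((4 : ℕ) : ℝ) * (n : ℝ) = ((4 * n : ℕ) : ℝ) by push_cast; ring, Real.rpow_natCast]
  -- C(N, m) ≤ (eN/m)^m ≤ (11 n)^m
  have hNle : (N : ℝ) ≤ (n : ℝ) ^ 2 := by
    exact_mod_cast Literature.Barriers.PneNP.card_sym2_fin_le n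
  have hchoose : ((N.choose m : ℕ) : ℝ) ≤ (11 * (n : ℝ)) ^ m := by
    refine (Literature.NumberTheory.Transcendental.RivoalSeries.choose_le_exp_pow hm1).trans
      (pow_le_pow_left₀ (by positivity) ?_ m)
    have hm0 : (0 : ℝ) < m := by exact_mod_cast hm1
    rw [div_le_iff₀ hm0]
    have he := Real.exp_one_lt_d9
    have hmr : (n : ℝ) ≤ 2 * (m : ℝ) + 1 := by exact_mod_cast h2m'
    have hn2 : (2 : ℝ) ≤ n := by exact_mod_cast hn
    nlinarith [Real.exp_pos 1, mul_le_mul_of_nonneg_left hNle (Real.exp_pos 1).le]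
  -- 11^m ≤ 4^n and n^m ≤ n^{n/2}
  have h11 : (11 : ℝ) ^ m ≤ (4 : ℝ) ^ n := by
    calc (11 : ℝ) ^ m ≤ (16 : ℝ) ^ m := pow_le_pow_left₀ (by norm_num) (by norm_num) m
      _ = (4 : ℝ) ^ (2 * m) := by rw [pow_mul]; norm_num
      _ ≤ (4 : ℝ) ^ n := pow_le_pow_right₀ (by norm_num) h2m
  have hnm : (n : ℝ) ^ m ≤ (n : ℝ) ^ ((n : ℝ) / 2) := by
    rw [← Real.rpow_natCast]
    apply Real.rpow_le_rpow_of_exponent_le hn1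
    have : (2 * m : ℝ) ≤ n := by exact_mod_cast h2m
    linarith
  have hX : ((((n / 2 + 1) * N.choose m : ℕ)) : ℝ) ≤ (n : ℝ) * ((4 : ℝ) ^ n * (n : ℝ) ^ ((n : ℝ) / 2)) := by
    have hm1' : (((n / 2 + 1 : ℕ)) : ℝ) ≤ n := by exact_mod_cast (show n / 2 + 1 ≤ n by omega)
    push_cast
    have hc : ((N.choose m : ℕ) : ℝ) ≤ (4 : ℝ) ^ n * (n : ℝ) ^ ((n : ℝ) / 2) := by
      calc ((N.choose m : ℕ) : ℝ) ≤ (11 * (n : ℝ)) ^ m := hchoose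
        _ = (11 : ℝ) ^ m * (n : ℝ) ^ m := mul_pow _ _ _
        _ ≤ (4 : ℝ) ^ n * (n : ℝ) ^ ((n : ℝ) / 2) :=
            mul_le_mul h11 hnm (by positivity) (by positivity)
    have := mul_le_mul hm1' hc (by positivity) (by positivity)
    simpa [hm] using this
  -- assemble
  have hD : (2 : ℝ) ^ (4 * n) = (2 : ℝ) ^ n * (4 : ℝ) ^ n * (2 : ℝ) ^ n := by
    rw [show 4 * n = n + 2 * n + n by ring, pow_add, pow_add, pow_mul]
    norm_num
  have hlt : (n : ℝ) / (2 : ℝ) ^ n < 1 := by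
    rw [div_lt_one (by positivity)]
    exact_mod_cast Nat.lt_two_pow_self
  rw [hsplit]
  calc ((2 ^ n : ℕ) : ℝ) * (((((n / 2 + 1) * N.choose m : ℕ)) : ℝ) *
        (((n : ℝ) ^ ((n : ℝ) / 2))⁻¹ * ((2 : ℝ) ^ (4 * n))⁻¹))
      ≤ ((2 ^ n : ℕ) : ℝ) * (((n : ℝ) * ((4 : ℝ) ^ n * (n : ℝ) ^ ((n : ℝ) / 2))) *
        (((n : ℝ) ^ ((n : ℝ) / 2))⁻¹ * ((2 : ℝ) ^ (4 * n))⁻¹)) := by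
        gcongr
    _ = (n : ℝ) / (2 : ℝ) ^ n := by
        rw [hD]
        push_cast
        field_simp
    _ < 1 := hlt

/-! ### The conditional refutation -/

/-- **HALF-SPARSE CORE** (the hypothesis `H` of this negative lemma; finite graph theory, no measure): every
loopless non-3-colourable edge set `G` over `Fin n` has a vertex set `S` with `2|S| ≥ n` and a non-3-colourable
sub-edge-set `F ⊆ G` with `2·|F[S]| ≤ n` (`F[S] = bobSide S F`, the edges of `F` inside `S`).  Equivalently: every
4-critical graph on `f` vertices has `≥ f/2` vertices spanning `≤ f/2` of its edges.  True for every family met by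
this crux programme (module docstring); open in general. -/
def HalfSparseCore : Prop :=
  ∀ (n : ℕ) (G : Finset (Sym2 (Fin n))), (∀ e ∈ G, ¬ e.IsDiag) →
    ¬ (SimpleGraph.fromEdgeSet (G : Set (Sym2 (Fin n)))).Colorable 3 →
    ∃ S : Finset (Fin n), n ≤ 2 * S.card ∧ ∃ F, F ⊆ G ∧
      ¬ (SimpleGraph.fromEdgeSet (F : Set (Sym2 (Fin n)))).Colorable 3 ∧ 2 * (bobSide S F).card ≤ n

/-- **X1 is false under the HALF-SPARSE-CORE hypothesis.**  `hH`: every loopless non-3-colourable edge set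
`G` over `Fin n` has a vertex set `S`, `2|S| ≥ n`, and a non-3-colourable `F ⊆ G` with `2·|F[S]| ≤ n`
(equivalently: every 4-critical graph on `f` vertices has `≥ f/2` vertices spanning `≤ f/2` of its edges; true
for every family met by this crux programme — see the module docstring — and open in general).  Then
`Summit.PneNP.PneNP.Theses.AeaCutRectangles.FoolingMeasure` fails: at `C = 4` and any large `n` of the
frequently-set, shrink `S` to a cut `B` of size `⌈n/2⌉` (inside X1's window once `ε·n ≥ 1`); the
`≤ 2^n·(n/2+1)·C(|Sym2 (Fin n)|, n/2)` Bob-superset rectangles of the pairs `(B, F[B])` carry the whole mass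
`1`, while X1 gives each mass `≤ n^{-n/2}·2^{-4n}` and `halfSparse_count_lt_one` says the total is `< 1`. -/
theorem foolingMeasure_false_of_halfSparseCore (hH : HalfSparseCore) :
    ¬ Summit.PneNP.PneNP.Theses.AeaCutRectangles.FoolingMeasure := by
  rintro ⟨ε, hε0, -, hC⟩
  obtain ⟨N₀, hN₀⟩ := exists_nat_gt (1 / ε)
  obtain ⟨n, hnN, μ, hμ, hsum, hs, hX⟩ := Filter.frequently_atTop.1 (hC 4) (N₀ + 2)
  have hn2 : 2 ≤ n := by omega
  have hnε : (1 : ℝ) ≤ ε * n := by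
    have hNn : (N₀ : ℝ) ≤ n := by exact_mod_cast (show N₀ ≤ n by omega)
    have h := mul_le_mul_of_nonneg_left hNn hε0.le
    have h' : 1 < ε * N₀ := by
      rw [div_lt_iff₀ hε0] at hN₀
      linarith
    linarith
  -- window predicate and budget
  set δ : ℝ := (2 : ℝ) ^ (-((n : ℝ) / 2 * Real.logb 2 n) - ((4 : ℕ) : ℝ) * n) with hδ
  have hδpos : 0 < δ := Real.rpow_pos_of_pos (by norm_num) _
  set m : ℕ := n / 2 with hm
  -- every support graph has a window cut with a half-sparse core
  have hrestr : ∀ S, μ S ≠ 0 → ∃ B : Finset (Fin n),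
      ((1 / 2 - ε) * (n : ℝ) ≤ B.card ∧ (B.card : ℝ) ≤ (1 / 2 + ε) * n) ∧ ∃ F, F ⊆ S ∧
        ¬ (SimpleGraph.fromEdgeSet (F : Set (Sym2 (Fin n)))).Colorable 3 ∧ (bobSide B F).card ≤ m := by
    intro S hS
    obtain ⟨hl, hc⟩ := hs S hS
    obtain ⟨T, hT, F, hFS, hF, hcard⟩ := hH n S hl hc
    obtain ⟨B, hBT, hBcard⟩ := exists_subset_card_eq (show (n + 1) / 2 ≤ T.card by omega)
    refine ⟨B, ⟨?_, ?_⟩, F, hFS, hF, ?_⟩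
    · rw [hBcard]
      have : (n : ℝ) ≤ 2 * (((n + 1) / 2 : ℕ) : ℝ) := by
        exact_mod_cast (show n ≤ 2 * ((n + 1) / 2) by omega)
      nlinarith
    · rw [hBcard]
      have : 2 * (((n + 1) / 2 : ℕ) : ℝ) ≤ n + 1 := by
        exact_mod_cast (show 2 * ((n + 1) / 2) ≤ n + 1 by omega)
      nlinarith
    · have := card_le_card (bobSide_mono_left hBT F)
      omega
  have htot := total_le_of_halfSparseCore μ hμ hs
    (fun B : Finset (Fin n) => (1 / 2 - ε) * (n : ℝ) ≤ B.card ∧ (B.card : ℝ) ≤ (1 / 2 + ε) * n)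
    hδpos.le (fun B hB => hX B hB.1 hB.2) m hrestr
  rw [hsum, Fintype.card_fin] at htot
  -- count
  have hP : (((univ : Finset (Finset (Sym2 (Fin n)))).filter (fun H => H.card ≤ m)).card : ℝ) ≤
      (((n / 2 + 1) * (Fintype.card (Sym2 (Fin n))).choose (n / 2) : ℕ) : ℝ) := by
    have h := card_filter_card_le_choose (Sym2 (Fin n)) m
      ((show 2 * m ≤ n by omega).trans (le_card_sym2_fin (by omega)))
    exact_mod_cast h
  have hlt := halfSparse_count_lt_one hn2
  rw [← hδ] at hlt
  have h2n : (0 : ℝ) ≤ ((2 ^ n : ℕ) : ℝ) := by positivity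
  have := mul_le_mul_of_nonneg_left (mul_le_mul_of_nonneg_right hP hδpos.le) h2n
  linarith

end Summit.PneNP.PneNP.Theorems.FoolingMeasure.Negative
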